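import Literature.MathematicalPhysics.QuantumLattice.FermionTorusTranslationSums
import Literature.MathematicalPhysics.QuantumLattice.InfVolFermionStateCompactness
import Literature.MathematicalPhysics.QuantumLattice.LocalPairOn
import Literature.MathematicalPhysics.QuantumLattice.HubbardWindowCertificate
import HarnessLib

/-!
# The pair field as a translation sum; locality of `[Δ_g, Δ_g†]`: `|⟨ψ, [Δ_g, Δ_g†] ψ⟩| ≤ C·L²`

Topic `Literature/MathematicalPhysics/QuantumLattice`; companion of `FermionTorusTranslationSums.lean`
(commutators of translation sums of even local observables are translation sums of a local density)
and `PairCorrelations.lean` (`pairField g L = Σ_x localPair g L x`). Everything is PROVED; no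
definition, no named fact.

* `localPairAt_mem_carEvenSubalgebra` — the local singlet pair `Δ_x = Σ_e (g e/√2)(c_{x↑}c_{x+e,↓} −
  c_{x↓}c_{x+e,↑})` of `ℤ²` is an EVEN element of its region algebra.
* `pairField_eq_sum_relabel_translate` — on the torus of side `L` (large enough for the pair region to
  fit), `Δ_g = Σ_{v ∈ (ℤ/L)²} T_v Γ(localPairAt S_d g 0)`, `S_d = {0, ±e₁, ±e₂}`: the pair field is the
  translation sum of the embedded local pair.
* `norm_torusAvgExpectAt_le_sum_norm` — `‖torusAvgExpectAt L Ω D ψ‖ ≤ Σ_{s,t} ‖D_{st}‖` for a unit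
  vector `ψ` (an `L`-independent bound by the entries of the LOCAL matrix `D`).
* `exists_norm_expect_doubleCommutator_pairField_le` — `‖⟨ψ, [O,[H_L,O]] ψ⟩‖ ≤ C·L²` for
  `O = Δ_g + Δ_g†`, `H_L = hubbardTorus 2 L t U` (the Horsch–von der Linden constant of Koma–Tasaki
  1994 Thm 2.2, without the commuting-densities hypothesis).
* `exists_norm_expect_commutator_pairField_le` — **locality of the pair-field commutator**: there
  are `C ≥ 0` and `L₀` (depending on `g` only) with `‖⟨ψ, (Δ_gΔ_g† − Δ_g†Δ_g) ψ⟩‖ ≤ C·L²` for every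
  `L ≥ L₀` and every unit `ψ` — although `Δ_gΔ_g†` and `Δ_g†Δ_g` are each of order `L⁴`, their
  commutator is the translation sum of a LOCAL density (Bratteli–Robinson II §6.2.1). This is the
  `O(L²)` constant `γ` of the one-point witness (`PairLROOnePointWitness*`: `⟨PᴴP⟩ + ⟨PPᴴ⟩ = 2⟨PᴴP⟩ +
  O(L²)` and the `O(L⁻²)` particle-number shift of the KHvdL superposition).

References: O. Bratteli, D. W. Robinson, *Operator Algebras and Quantum Statistical Mechanics 2*,
2nd ed. (Springer 1997), §5.2.2, §6.2.1 [BratteliRobinsonII1997]; D. J. Scalapino, Phys. Rep. 250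
(1995) 329, §2 eq. (2.2) (the pair field) [Scalapino1995]; T. Koma, H. Tasaki, J. Stat. Phys. 76
(1994) 745, Theorem 2.2 [KomaTasaki1994].
-/

noncomputable section

namespace Literature.MathematicalPhysics.QuantumLattice

open Matrix Finset HubbardWave0 Literature.Probability.LatticeModels
open scoped ComplexOrder

/-! ### The local pair is even -/

/-- The local singlet pair `localPairAt S g x` is an even element of `𝔄_{pairRegion S x}` (a sum of
products of two annihilation operators). [cite: BratteliRobinsonII1997, §5.2.2] -/
theorem localPairAt_mem_carEvenSubalgebra (S : Finset (Site 2)) (g : Site 2 → ℝ) (x : Site 2) :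
    localPairAt S g x ∈ carEvenSubalgebra (Finset.univ : Finset (Orb (PolySite (pairRegion S x)))) := by
  unfold localPairAt
  refine Subalgebra.sum_mem _ fun e _ => Subalgebra.smul_mem _ (Subalgebra.sub_mem _ ?_ ?_) _
  · exact Algebra.subset_adjoin ⟨(_, false), (_, false), Finset.mem_univ _, Finset.mem_univ _, rfl⟩
  · exact Algebra.subset_adjoin ⟨(_, false), (_, false), Finset.mem_univ _, Finset.mem_univ _, rfl⟩

/-! ### The pair field is a translation sum -/

section TranslationSum

variable (g : Site 2 → ℝ) (L : ℕ) [NeZero L]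

/-- **`Δ_g = Σ_v T_v Γ(localPairAt S_d g 0)`**, `S_d = {0} ∪ unitSteps`: the torus pair field is the
translation sum of the embedded local pair at the origin (`Γ(localPairAt S g 0) = localPair g L 0`,
`T_v (localPair g L 0) = localPair g L v`). [cite: Scalapino1995, §2 eq. (2.2)] -/
theorem pairField_eq_sum_relabel_translate
    (h : Set.InjOn (Torus.proj (d := 2) L) ↑(pairRegion (insert (0 : Site 2) unitSteps) 0)) :
    pairField g L = ∑ v : TorusSite 2 L, relabel (Orb.translate v)
      (fermionEmbed (PolySite.toTorusEmb L h) (localPairAt (insert (0 : Site 2) unitSteps) g 0)) := by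
  rw [fermionEmbed_toTorusEmb_localPairAt L _ g 0 h, localPairOn_insert_zero_unitSteps]
  have h0 : Torus.proj L (0 : Site 2) = (0 : TorusSite 2 L) := by funext i; simp [Torus.proj]
  simp_rw [h0, relabel_translate_localPair, zero_add]
  rfl

/-- The adjoint pair field `Δ_g†` is the translation sum of the embedded adjoint local pair
(adjoint of Scalapino's `Δ_g = Σ_x Δ_x`). [cite: Scalapino1995, §2 eq. (2.2)] -/
theorem pairField_conjTranspose_eq_sum_relabel_translate
    (h : Set.InjOn (Torus.proj (d := 2) L) ↑(pairRegion (insert (0 : Site 2) unitSteps) 0)) :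
    (pairField g L)ᴴ = ∑ v : TorusSite 2 L, relabel (Orb.translate v)
      (fermionEmbed (PolySite.toTorusEmb L h) (localPairAt (insert (0 : Site 2) unitSteps) g 0)ᴴ) := by
  rw [pairField_eq_sum_relabel_translate g L h, conjTranspose_sum]
  refine Finset.sum_congr rfl fun v _ => ?_
  rw [fermionEmbed_conjTranspose, relabel_conjTranspose]

end TranslationSum

/-! ### An `L`-independent bound on averaged torus expectations of a local matrix -/

/-- `‖torusAvgExpectAt L Ω D ψ‖ ≤ Σ_{s,t} ‖D_{st}‖` for a unit vector `ψ` (expand `D` in matrix units;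
each unit has averaged expectation of modulus `≤ 1`): the translation-averaged vector state is a state,
hence bounded — here in the crude entrywise form, uniform in the side `L`.
[cite: BratteliRobinsonI1987, Prop. 2.3.11] -/
theorem norm_torusAvgExpectAt_le_sum_norm {d : ℕ} (L : ℕ) [NeZero L] (Ω : Finset (Site d)) (D : FermionOp Ω)
    {ψ : Fock (Orb (FermionTorus d L))} (hψ : star ψ ⬝ᵥ ψ = 1) :
    ‖torusAvgExpectAt L Ω D ψ‖ ≤ ∑ s, ∑ t, ‖D s t‖ := by
  rw [← torusAvgExpect_eq, torusAvgExpect_eq_sum_single]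
  refine (norm_sum_le _ _).trans (Finset.sum_le_sum fun s _ => (norm_sum_le _ _).trans
    (Finset.sum_le_sum fun t _ => ?_))
  rw [norm_mul]
  exact (mul_le_mul_of_nonneg_left (norm_torusAvgExpect_single_le L Ω s t hψ) (norm_nonneg _)).trans
    (by rw [mul_one])

/-! ### Locality of `[Δ_g, Δ_g†]` -/

/-- **`‖⟨ψ, (Δ_g Δ_g† − Δ_g† Δ_g) ψ⟩‖ ≤ C·L²` uniformly in the unit vector `ψ` and the side `L ≥ L₀`.**
The commutator of the two translation sums `Δ_g = Σ_v T_v Γ(A)`, `Δ_g† = Σ_w T_w Γ(Aᴴ)` (`A` the even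
local pair) is the translation sum of the local density `Σ_z [τ_z A, Aᴴ]` over the finitely many offsets
`z` at which the supports meet, whose expectation per site is an averaged torus expectation of a fixed
local matrix. [cite: BratteliRobinsonII1997, §6.2.1] -/
theorem exists_norm_expect_commutator_pairField_le (g : Site 2 → ℝ) :
    ∃ C : ℝ, ∃ L₀ : ℕ, 0 ≤ C ∧ ∀ (L : ℕ) [NeZero L], L₀ ≤ L →
      ∀ ψ : Fock (Orb (FermionTorus 2 L)), star ψ ⬝ᵥ ψ = 1 →
        ‖expect (pairField g L * (pairField g L)ᴴ - (pairField g L)ᴴ * pairField g L) ψ‖ ≤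
          C * (L : ℝ) ^ 2 := by
  -- regions
  set S : Finset (Site 2) := insert (0 : Site 2) unitSteps with hS
  set ΛA : Finset (Site 2) := pairRegion S 0 with hΛA
  set A : FermionOp ΛA := localPairAt S g 0 with hAdef
  set Z : Finset (Site 2) := (ΛA ×ˢ ΛA).image (fun p => p.1 - p.2) with hZ
  set Ω : Finset (Site 2) := ΛA ∪ Z.biUnion (fun z => shiftSet z ΛA) with hΩ
  have hA : ΛA ⊆ Ω := Finset.subset_union_left
  have hZΩ : ∀ z ∈ Z, shiftSet z ΛA ⊆ Ω := fun z hz =>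
    (Finset.subset_biUnion_of_mem (fun z => shiftSet z ΛA) hz).trans Finset.subset_union_right
  have hcomplete : ∀ a ∈ ΛA, ∀ c ∈ ΛA, c - a ∈ Z := fun a ha c hc =>
    Finset.mem_image.2 ⟨(c, a), Finset.mem_product.2 ⟨hc, ha⟩, rfl⟩
  set D : FermionOp Ω := commDensity Ω Z hA A Aᴴ with hDdef
  -- the constant and the threshold
  obtain ⟨L₁, hL₁⟩ := exists_forall_le_injOn_proj Ω
  obtain ⟨L₂, hL₂⟩ := exists_forall_le_injOn_proj Z
  refine ⟨∑ s, ∑ t, ‖D s t‖, max L₁ L₂, Finset.sum_nonneg fun s _ => Finset.sum_nonneg fun t _ => norm_nonneg _,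
    fun L _ hL ψ hψ => ?_⟩
  have hΩinj : Set.InjOn (Torus.proj (d := 2) L) ↑Ω := hL₁ L (le_trans (le_max_left _ _) hL)
  have hZinj : Set.InjOn (Torus.proj (d := 2) L) ↑Z := hL₂ L (le_trans (le_max_right _ _) hL)
  have hAinj : Set.InjOn (Torus.proj (d := 2) L) ↑ΛA := hΩinj.mono (Finset.coe_subset.2 hA)
  -- the pair field and its adjoint as translation sums (with the embedding proof of the lemma)
  have hP : pairField g L = ∑ v : TorusSite 2 L, relabel (Orb.translate v)
      (fermionEmbed (PolySite.toTorusEmb L (hΩinj.mono (Finset.coe_subset.2 hA))) A) :=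
    pairField_eq_sum_relabel_translate g L _
  have hPd : (pairField g L)ᴴ = ∑ v : TorusSite 2 L, relabel (Orb.translate v)
      (fermionEmbed (PolySite.toTorusEmb L (hΩinj.mono (Finset.coe_subset.2 hA))) Aᴴ) :=
    pairField_conjTranspose_eq_sum_relabel_translate g L _
  have key := expect_commutator_sum_relabel_translate L hΩinj hZinj hA hA hZΩ hcomplete
    (localPairAt_mem_carEvenSubalgebra S g 0) Aᴴ ψ
  rw [← hP, ← hPd] at key
  rw [key, norm_mul, norm_pow, Complex.norm_natCast, mul_comm]
  exact mul_le_mul_of_nonneg_right (norm_torusAvgExpectAt_le_sum_norm L Ω D hψ) (by positivity)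

/-- Real-part form: `|Re⟨ψ, (Δ_g Δ_g† − Δ_g† Δ_g) ψ⟩| ≤ C·L²` — the hypothesis `γ` of
`PairLROOnePointWitness.eucNorm_le_two_mul_of_onePointCeiling` grows like `L²`, not `L⁴`.
[cite: BratteliRobinsonII1997, §6.2.1] -/
theorem exists_abs_re_expect_commutator_pairField_le (g : Site 2 → ℝ) :
    ∃ C : ℝ, ∃ L₀ : ℕ, 0 ≤ C ∧ ∀ (L : ℕ) [NeZero L], L₀ ≤ L →
      ∀ ψ : Fock (Orb (FermionTorus 2 L)), star ψ ⬝ᵥ ψ = 1 →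
        |(expect (pairField g L * (pairField g L)ᴴ - (pairField g L)ᴴ * pairField g L) ψ).re| ≤
          C * (L : ℝ) ^ 2 := by
  obtain ⟨C, L₀, hC, h⟩ := exists_norm_expect_commutator_pairField_le g
  exact ⟨C, L₀, hC, fun L _ hL ψ hψ => (Complex.abs_re_le_norm _).trans (h L hL ψ hψ)⟩

/-! ### Locality of the double commutator `[O, [H_L, O]]`, `O = Δ_g + Δ_g†` -/

/-- The adjoint local pair `(localPairAt S g x)ᴴ` is even (a sum of products of two creation
operators). [cite: BratteliRobinsonII1997, §5.2.2] -/
theorem localPairAt_conjTranspose_mem_carEvenSubalgebra (S : Finset (Site 2)) (g : Site 2 → ℝ) (x : Site 2) :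
    (localPairAt S g x)ᴴ ∈ carEvenSubalgebra (Finset.univ : Finset (Orb (PolySite (pairRegion S x)))) := by
  unfold localPairAt
  rw [conjTranspose_sum]
  refine Subalgebra.sum_mem _ fun e _ => ?_
  rw [conjTranspose_smul, conjTranspose_sub, conjTranspose_mul, conjTranspose_mul]
  simp only [cAt, annihilation_conjTranspose]
  refine Subalgebra.smul_mem _ (Subalgebra.sub_mem _ ?_ ?_) _
  · exact Algebra.subset_adjoin ⟨(_, true), (_, true), Finset.mem_univ _, Finset.mem_univ _, rfl⟩
  · exact Algebra.subset_adjoin ⟨(_, true), (_, true), Finset.mem_univ _, Finset.mem_univ _, rfl⟩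

/-- **`‖⟨ψ, [O, [H_L, O]] ψ⟩‖ ≤ C·L²` for `O = Δ_g + Δ_g†` and the Hubbard torus Hamiltonian
`H_L = hubbardTorus 2 L t U`, uniformly in the unit vector `ψ` and the side `L ≥ L₀`.** `O` is the
translation sum of the even local observable `A + Aᴴ` (`A` the local pair at the origin); `[H_L, O]` is
the translation sum of the embedded local commutator `[H_{Λ'}, A + Aᴴ]`
(`hubbardTorus_commutator_sum_relabel_translate`); the commutator of the two translation sums is the
translation sum of a local density (`expect_commutator_sum_relabel_translate`). This is the `O(L²)`
constant of the Horsch–von der Linden double-commutator identity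
`⟨Ψ, HΨ⟩ − E = ⟨[[O,H],O]⟩/(2‖Oψ‖²)` (Koma–Tasaki 1994, Theorem 2.2: `‖[[O,H],O]‖ ≤ 4r²ho²N`), here
WITHOUT the hypothesis that the order-operator densities commute at different sites (bond pairs
sharing a site do not). [cite: KomaTasaki1994, Theorem 2.2 (2.9)] [cite: BratteliRobinsonII1997, §6.2.1] -/
theorem exists_norm_expect_doubleCommutator_pairField_le (g : Site 2 → ℝ) (t U : ℝ) :
    ∃ C : ℝ, ∃ L₀ : ℕ, 0 ≤ C ∧ ∀ (L : ℕ) [NeZero L], L₀ ≤ L →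
      ∀ ψ : Fock (Orb (FermionTorus 2 L)), star ψ ⬝ᵥ ψ = 1 →
        ‖expect ((pairField g L + (pairField g L)ᴴ) *
              (hubbardTorus 2 L t U * (pairField g L + (pairField g L)ᴴ) -
                (pairField g L + (pairField g L)ᴴ) * hubbardTorus 2 L t U) -
            (hubbardTorus 2 L t U * (pairField g L + (pairField g L)ᴴ) -
                (pairField g L + (pairField g L)ᴴ) * hubbardTorus 2 L t U) *
              (pairField g L + (pairField g L)ᴴ)) ψ‖ ≤ C * (L : ℝ) ^ 2 := by
  -- regions and local data
  set S : Finset (Site 2) := insert (0 : Site 2) unitSteps with hS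
  set ΛA : Finset (Site 2) := pairRegion S 0 with hΛA
  set A : FermionOp ΛA := localPairAt S g 0 with hAdef
  set Oloc : FermionOp ΛA := A + Aᴴ with hOloc
  have hOeven : Oloc ∈ carEvenSubalgebra (Finset.univ : Finset (Orb (PolySite ΛA))) :=
    add_mem (localPairAt_mem_carEvenSubalgebra S g 0) (localPairAt_conjTranspose_mem_carEvenSubalgebra S g 0)
  set Λ' : Finset (Site 2) := thicken ΛA 1 with hΛ'
  have hAΛ' : ΛA ⊆ Λ' := subset_thicken ΛA 1
  have hclosed : ∀ x ∈ ΛA, ∀ i : Fin 2, x + unitVec i ∈ Λ' ∧ x - unitVec i ∈ Λ' :=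
    fun x hx i => ⟨add_unitVec_mem_thicken_one hx i, sub_unitVec_mem_thicken_one hx i⟩
  set Cloc : FermionOp Λ' := (hubbardFermionInteraction 2 t U).localHamiltonian Λ' * fermionEmbed (PolySite.incl hAΛ') Oloc -
    fermionEmbed (PolySite.incl hAΛ') Oloc * (hubbardFermionInteraction 2 t U).localHamiltonian Λ' with hCloc
  set Z : Finset (Site 2) := (Λ' ×ˢ ΛA).image (fun p => p.1 - p.2) with hZ
  set Ω : Finset (Site 2) := (ΛA ∪ Λ') ∪ Z.biUnion (fun z => shiftSet z ΛA) with hΩ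
  have hA : ΛA ⊆ Ω := Finset.subset_union_left.trans Finset.subset_union_left
  have hC : Λ' ⊆ Ω := Finset.subset_union_right.trans Finset.subset_union_left
  have hZΩ : ∀ z ∈ Z, shiftSet z ΛA ⊆ Ω := fun z hz =>
    (Finset.subset_biUnion_of_mem (fun z => shiftSet z ΛA) hz).trans Finset.subset_union_right
  have hcomplete : ∀ a ∈ ΛA, ∀ c ∈ Λ', c - a ∈ Z := fun a ha c hc =>
    Finset.mem_image.2 ⟨(c, a), Finset.mem_product.2 ⟨hc, ha⟩, rfl⟩
  set D : FermionOp Ω := commDensity Ω Z hC Oloc Cloc with hDdef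
  -- thresholds
  obtain ⟨L₁, hL₁⟩ := exists_forall_le_injOn_proj Ω
  obtain ⟨L₂, hL₂⟩ := exists_forall_le_injOn_proj Z
  obtain ⟨L₃, hL₃⟩ := exists_forall_le_injOn_proj (thicken Λ' 1)
  refine ⟨∑ s, ∑ t, ‖D s t‖, max (max L₁ L₂) L₃,
    Finset.sum_nonneg fun s _ => Finset.sum_nonneg fun t _ => norm_nonneg _, fun L _ hL ψ hψ => ?_⟩
  have hΩinj : Set.InjOn (Torus.proj (d := 2) L) ↑Ω :=
    hL₁ L (le_trans (le_trans (le_max_left _ _) (le_max_left _ _)) hL)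
  have hZinj : Set.InjOn (Torus.proj (d := 2) L) ↑Z :=
    hL₂ L (le_trans (le_trans (le_max_right _ _) (le_max_left _ _)) hL)
  have hTinj : Set.InjOn (Torus.proj (d := 2) L) ↑(thicken Λ' 1) := hL₃ L (le_trans (le_max_right _ _) hL)
  -- `O` as a translation sum of `Γ_{ΛA} Oloc`, written with the embedding proofs of the two lemmas
  have hO1 : pairField g L + (pairField g L)ᴴ = ∑ v : TorusSite 2 L, relabel (Orb.translate v)
      (fermionEmbed (PolySite.toTorusEmb L (hΩinj.mono (Finset.coe_subset.2 hA))) Oloc) := by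
    rw [pairField_conjTranspose_eq_sum_relabel_translate g L (hΩinj.mono (Finset.coe_subset.2 hA)),
      pairField_eq_sum_relabel_translate g L (hΩinj.mono (Finset.coe_subset.2 hA)),
      ← Finset.sum_add_distrib]
    refine Finset.sum_congr rfl fun v _ => ?_
    rw [← relabel_add, ← fermionEmbed_add]
  have hO2 : pairField g L + (pairField g L)ᴴ = ∑ v : TorusSite 2 L, relabel (Orb.translate v)
      (fermionEmbed (PolySite.toTorusEmb L (hTinj.mono (by exact_mod_cast subset_thicken Λ' 1)))
        (fermionEmbed (PolySite.incl hAΛ') Oloc)) := by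
    rw [hO1]
    refine Finset.sum_congr rfl fun v _ => ?_
    rw [fermionEmbed_toTorusEmb_incl]
  -- `[H, O]` as a translation sum of `Γ_{Λ'} Cloc`
  have hHO : hubbardTorus 2 L t U * (pairField g L + (pairField g L)ᴴ) -
      (pairField g L + (pairField g L)ᴴ) * hubbardTorus 2 L t U =
      ∑ w : TorusSite 2 L, relabel (Orb.translate w)
        (fermionEmbed (PolySite.toTorusEmb L (hΩinj.mono (Finset.coe_subset.2 hC))) Cloc) := by
    rw [hO2, hubbardTorus_commutator_sum_relabel_translate L t U hAΛ' hclosed hTinj Oloc]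
  have key := expect_commutator_sum_relabel_translate L hΩinj hZinj hA hC hZΩ hcomplete hOeven Cloc ψ
  rw [← hO1, ← hHO] at key
  rw [key, norm_mul, norm_pow, Complex.norm_natCast, mul_comm]
  exact mul_le_mul_of_nonneg_right (norm_torusAvgExpectAt_le_sum_norm L Ω D hψ) (by positivity)

end Literature.MathematicalPhysics.QuantumLattice

end
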